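import Mathlib
import Literature.Analysis.FluidPDE.VectorCalculus
import Literature.Analysis.FluidPDE.VectorCalculusProofs
import Summits.NavierStokesRegularity.NavierStokesRegularity.Theorems.SlicedKelvinPlanarFluxAPrioriSqrtReg
import Summits.NavierStokesRegularity.NavierStokesRegularity.Theorems.SlicedKelvinPlanarFluxAPrioriPlaneCalculus
import Summits.NavierStokesRegularity.NavierStokesRegularity.Theorems.SlicedKelvinPlanarFluxAPrioriPlaneChart
import Summits.NavierStokesRegularity.NavierStokesRegularity.Theorems.SlicedKelvinPlanarFluxAPrioriFoldPointwise
import Summits.NavierStokesRegularity.NavierStokesRegularity.Theorems.SlicedKelvinPlanarFluxAPrioriFoldDecay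

/-!
# Crux `SlicedKelvin.PlanarFluxAPriori` (stmt-NavierStokesRegularity-15600), line `Sketch`:
  the height derivative of the regularised apex functional (helper for `stub_apexLipschitz`)

The registered stub `stub_apexLipschitz` of the lead's skeleton
`Cruxes/PlanarFluxAPriori/Lines/Sketch.lean` is the half-space apex identity in Lipschitz form.
Fix a frame `R` (`n = R e₂`, `eᵢ = R eᵢ`), a smooth field `v` whose derivatives of orders `≤ 3`
decay like `(1 + ‖x‖)⁻³`, `ω = curl v`, `f = ⟪ω, n⟫`, `ε > 0`, the odd regularisation
`H(s) = s/√(s² + ε²)` (`H'(s) = ε²/√(s² + ε²)³`) and the frame components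
`G_e = H(f) ⟪ω, e⟫` of the field `H(f) ω` (so `G_n = H(f) f = f²/√(f² + ε²)`, the plane
integrand of the stub). This file proves the calculus behind the identity:

* `apexLipschitz_fderiv_signReg_mul_inner_apply` — `D G_e[h] = H(f)⟪e, Dω h⟫ + ⟪ω, e⟫ H'(f)⟪n, Dω h⟫`
  (product and chain rules on top of the landed `hasFDerivAt_div_sqrtReg_comp`,
  `hasFDerivAt_inner_const` of `…FoldPointwise`);
* `apexLipschitz_fderiv_signReg_normal_eq` — the POINTWISE apex identity
  `D G_n[n] = H'(f) Df[ω] − D G_{e₀}[e₀] − D G_{e₁}[e₁]` for a field with `div ω = 0`, i.e.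
  `div (H(f) ω) = H'(f) Df[ω] + H(f) div ω` in the orthonormal frame `(R e₀, R e₁, R e₂)`
  (`divergence_eq_sum_inner_fderiv`, `OrthonormalBasis.sum_repr'`);
* `apexLipschitz_hasDerivAt_planeIntegral` — the plane integrals `g(s) = ∫_{R{x₂ = s}} f²/√(f²+ε²)`
  are differentiable in the height with `g'(s) = ∫_{R{x₂ = s}} H'(f) Df[ω]`: differentiate under the
  integral sign (`hasDerivAt_planeIntegral_height` of `…PlaneCalculus`; `|G_n| ≤ |f|`,
  `‖D G_n‖ ≤ (1 + ε⁻¹ sup ‖ω‖) ‖Dω‖` decay cubically by `…FoldDecay`), insert the pointwise identity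
  with `div curl v = 0` (`divergence_curl_eq_zero_holds`) and drop the in-plane divergence
  (`integral_fderiv_planeChart_eq_zero` of `…PlaneChart`, the integrands decaying cubically);
Mathlib + `Literature.Analysis.FluidPDE.{VectorCalculus, VectorCalculusProofs}` + the landed
`…PlanarFluxAPriori{SqrtReg, PlaneCalculus, PlaneChart, FoldPointwise, FoldDecay}`.
-/

noncomputable section

namespace Summit.NavierStokesRegularity.NavierStokesRegularity.Theorems.SlicedKelvinPlanarFluxAPriori

set_option linter.dupNamespace false
-- the summit and its single sub-problem share the name (CONVENTIONS §1)

open MeasureTheory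
open Literature.Analysis.FluidPDE
open scoped InnerProductSpace RealInnerProductSpace ContDiff

/-- Derivative of the frame components `G_e = H_ε(f) ⟪w, e⟫` of the field `H_ε(f) w`, where
`f = ⟪w, n⟫`, `H_ε(s) = s/√(s² + ε²)`, `H_ε'(s) = ε²/√(s² + ε²)³`:
`D G_e(x)[h] = H_ε(f x) ⟪e, Dw(x) h⟫ + ⟪w x, e⟫ H_ε'(f x) ⟪n, Dw(x) h⟫`. -/
theorem apexLipschitz_hasFDerivAt_signReg_mul_inner {ε : ℝ} (hε : 0 < ε)
    {w : EuclideanSpace ℝ (Fin 3) → EuclideanSpace ℝ (Fin 3)} {x : EuclideanSpace ℝ (Fin 3)}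
    (hw : DifferentiableAt ℝ w x) (n e : EuclideanSpace ℝ (Fin 3)) :
    HasFDerivAt (fun z => ⟪w z, n⟫ / Real.sqrt (⟪w z, n⟫ ^ 2 + ε ^ 2) * ⟪w z, e⟫)
      ((⟪w x, n⟫ / Real.sqrt (⟪w x, n⟫ ^ 2 + ε ^ 2)) • ((innerSL ℝ e).comp (fderiv ℝ w x)) +
        ⟪w x, e⟫ • ((ε ^ 2 / Real.sqrt (⟪w x, n⟫ ^ 2 + ε ^ 2) ^ 3) •
          ((innerSL ℝ n).comp (fderiv ℝ w x)))) x :=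
  (hasFDerivAt_div_sqrtReg_comp hε (hasFDerivAt_inner_const hw.hasFDerivAt n)).fun_mul
    (hasFDerivAt_inner_const hw.hasFDerivAt e)

/-- The directional form of `apexLipschitz_hasFDerivAt_signReg_mul_inner`:
`D G_e(x)[h] = H_ε(f x) ⟪e, Dw(x) h⟫ + ⟪w x, e⟫ (H_ε'(f x) ⟪n, Dw(x) h⟫)`. -/
theorem apexLipschitz_fderiv_signReg_mul_inner_apply {ε : ℝ} (hε : 0 < ε)
    {w : EuclideanSpace ℝ (Fin 3) → EuclideanSpace ℝ (Fin 3)} {x : EuclideanSpace ℝ (Fin 3)}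
    (hw : DifferentiableAt ℝ w x) (n e h : EuclideanSpace ℝ (Fin 3)) :
    fderiv ℝ (fun z => ⟪w z, n⟫ / Real.sqrt (⟪w z, n⟫ ^ 2 + ε ^ 2) * ⟪w z, e⟫) x h =
      ⟪w x, n⟫ / Real.sqrt (⟪w x, n⟫ ^ 2 + ε ^ 2) * ⟪e, fderiv ℝ w x h⟫ +
        ⟪w x, e⟫ * (ε ^ 2 / Real.sqrt (⟪w x, n⟫ ^ 2 + ε ^ 2) ^ 3 * ⟪n, fderiv ℝ w x h⟫) := by
  rw [(apexLipschitz_hasFDerivAt_signReg_mul_inner hε hw n e).fderiv]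
  simp only [add_apply, smul_apply, smul_eq_mul,
    ContinuousLinearMap.comp_apply, innerSL_apply_apply]

/-- **The pointwise apex identity** (`div (H_ε(f) w) = H_ε'(f) Df[w]` for a divergence-free `w`,
solved for the normal term). In the frame `R` (`n = R e₂`, `eᵢ = R eᵢ`), with `f = ⟪w, n⟫` and
`G_e = H_ε(f) ⟪w, e⟫`: if `div w (x) = 0` then
`D G_n(x)[n] = H_ε'(f x) Df(x)[w x] − D G_{e₀}(x)[e₀] − D G_{e₁}(x)[e₁]`. -/
theorem apexLipschitz_fderiv_signReg_normal_eq {ε : ℝ} (hε : 0 < ε)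
    (R : EuclideanSpace ℝ (Fin 3) ≃ₗᵢ[ℝ] EuclideanSpace ℝ (Fin 3))
    {w : EuclideanSpace ℝ (Fin 3) → EuclideanSpace ℝ (Fin 3)} {x : EuclideanSpace ℝ (Fin 3)}
    (hw : DifferentiableAt ℝ w x) (hdiv : VectorCalculus.divergence w x = 0) :
    fderiv ℝ (fun z => ⟪w z, R (EuclideanSpace.single 2 1)⟫ /
        Real.sqrt (⟪w z, R (EuclideanSpace.single 2 1)⟫ ^ 2 + ε ^ 2) *
          ⟪w z, R (EuclideanSpace.single 2 1)⟫) x (R (EuclideanSpace.single 2 1)) =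
      ε ^ 2 / Real.sqrt (⟪w x, R (EuclideanSpace.single 2 1)⟫ ^ 2 + ε ^ 2) ^ 3 *
          fderiv ℝ (fun z => ⟪w z, R (EuclideanSpace.single 2 1)⟫) x (w x) -
        fderiv ℝ (fun z => ⟪w z, R (EuclideanSpace.single 2 1)⟫ /
          Real.sqrt (⟪w z, R (EuclideanSpace.single 2 1)⟫ ^ 2 + ε ^ 2) *
            ⟪w z, R (EuclideanSpace.single 0 1)⟫) x (R (EuclideanSpace.single 0 1)) -
        fderiv ℝ (fun z => ⟪w z, R (EuclideanSpace.single 2 1)⟫ /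
          Real.sqrt (⟪w z, R (EuclideanSpace.single 2 1)⟫ ^ 2 + ε ^ 2) *
            ⟪w z, R (EuclideanSpace.single 1 1)⟫) x (R (EuclideanSpace.single 1 1)) := by
  set b : OrthonormalBasis (Fin 3) ℝ (EuclideanSpace ℝ (Fin 3)) :=
    (EuclideanSpace.basisFun (Fin 3) ℝ).map R with hb_def
  have hb : ∀ i, b i = R (EuclideanSpace.single i 1) := fun i => by
    rw [hb_def, OrthonormalBasis.map_apply, EuclideanSpace.basisFun_apply]
  -- `div w = 0` in the frame
  have hdiv' : ⟪R (EuclideanSpace.single 0 1), fderiv ℝ w x (R (EuclideanSpace.single 0 1))⟫ +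
      ⟪R (EuclideanSpace.single 1 1), fderiv ℝ w x (R (EuclideanSpace.single 1 1))⟫ +
      ⟪R (EuclideanSpace.single 2 1), fderiv ℝ w x (R (EuclideanSpace.single 2 1))⟫ = 0 := by
    rw [divergence_eq_sum_inner_fderiv b, Fin.sum_univ_three, hb, hb, hb] at hdiv
    exact hdiv
  -- `Df[w] = Σᵢ ⟪w, eᵢ⟫ ⟪n, Dw eᵢ⟫`
  have hq : fderiv ℝ (fun z => ⟪w z, R (EuclideanSpace.single 2 1)⟫) x (w x) =
      ⟪w x, R (EuclideanSpace.single 0 1)⟫ *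
          ⟪R (EuclideanSpace.single 2 1), fderiv ℝ w x (R (EuclideanSpace.single 0 1))⟫ +
        ⟪w x, R (EuclideanSpace.single 1 1)⟫ *
          ⟪R (EuclideanSpace.single 2 1), fderiv ℝ w x (R (EuclideanSpace.single 1 1))⟫ +
        ⟪w x, R (EuclideanSpace.single 2 1)⟫ *
          ⟪R (EuclideanSpace.single 2 1), fderiv ℝ w x (R (EuclideanSpace.single 2 1))⟫ := by
    rw [fderiv_inner_const_apply hw]
    conv_lhs => rw [← b.sum_repr' (w x)]
    simp only [Fin.sum_univ_three, map_add, map_smul, inner_add_right, real_inner_smul_right, hb]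
    rw [real_inner_comm (w x) (R (EuclideanSpace.single 0 1)),
      real_inner_comm (w x) (R (EuclideanSpace.single 1 1)),
      real_inner_comm (w x) (R (EuclideanSpace.single 2 1))]
  rw [apexLipschitz_fderiv_signReg_mul_inner_apply hε hw, apexLipschitz_fderiv_signReg_mul_inner_apply hε hw,
    apexLipschitz_fderiv_signReg_mul_inner_apply hε hw, hq,
    show ⟪R (EuclideanSpace.single 2 1), fderiv ℝ w x (R (EuclideanSpace.single 2 1))⟫ =
      -⟪R (EuclideanSpace.single 0 1), fderiv ℝ w x (R (EuclideanSpace.single 0 1))⟫ -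
        ⟪R (EuclideanSpace.single 1 1), fderiv ℝ w x (R (EuclideanSpace.single 1 1))⟫ by linarith]
  ring

/-- Bookkeeping: `x ↦ L(x)[u x]` decays when the linear forms `L x` decay and `u` is bounded. -/
theorem apexLipschitz_decay_clm_apply {L : EuclideanSpace ℝ (Fin 3) → EuclideanSpace ℝ (Fin 3) →L[ℝ] ℝ}
    {u : EuclideanSpace ℝ (Fin 3) → EuclideanSpace ℝ (Fin 3)} {K : ℝ}
    (hL : ∀ x, (1 + ‖x‖) ^ 3 * ‖L x‖ ≤ K) (hu : ∃ B : ℝ, ∀ x, ‖u x‖ ≤ B) :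
    ∃ K : ℝ, ∀ x, (1 + ‖x‖) ^ 3 * ‖L x (u x)‖ ≤ K := by
  obtain ⟨B, hB⟩ := hu
  refine ⟨K * B, fun x => ?_⟩
  calc (1 + ‖x‖) ^ 3 * ‖L x (u x)‖ ≤ (1 + ‖x‖) ^ 3 * (‖L x‖ * ‖u x‖) := by
        gcongr; exact (L x).le_opNorm _
    _ = (1 + ‖x‖) ^ 3 * ‖L x‖ * ‖u x‖ := by ring
    _ ≤ K * B := mul_le_mul (hL x) (hB x) (norm_nonneg _) ((hL x).trans' (by positivity))

/-- **The height derivative of the regularised apex functional.** For a smooth field `v` with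
cubic decay of its derivatives of orders `≤ 3`, a frame `R` (`n = R e₂`), `ω = curl v`,
`f = ⟪ω, n⟫` and `ε > 0`, the plane integrals `g(s) = ∫_{R{x₂ = s}} f²/√(f² + ε²)` are
differentiable in the height with `g'(s) = ∫_{R{x₂ = s}} (ε²/√(f² + ε²)³) Df[ω]`: differentiate
under the integral (`hasDerivAt_planeIntegral_height`), use the pointwise apex identity
`apexLipschitz_fderiv_signReg_normal_eq` (`div curl v = 0`) and drop the in-plane divergence
(`integral_fderiv_planeChart_eq_zero`). -/
theorem apexLipschitz_hasDerivAt_planeIntegral : ∀ (ε : ℝ), 0 < ε → ∀ (R : EuclideanSpace ℝ (Fin 3) ≃ₗᵢ[ℝ] EuclideanSpace ℝ (Fin 3)) (v : EuclideanSpace ℝ (Fin 3) → EuclideanSpace ℝ (Fin 3)) (C : ℝ), ContDiff ℝ (⊤ : ℕ∞) v → (∀ (x : EuclideanSpace ℝ (Fin 3)) (k : ℕ), k ≤ 3 → (1 + ‖x‖) ^ 3 * ‖iteratedFDeriv ℝ k v x‖ ≤ C) → ∀ (s : ℝ), HasDerivAt (fun s : ℝ => ∫ y : EuclideanSpace ℝ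 (Fin 2), inner ℝ (Literature.Analysis.FluidPDE.curl v (R (WithLp.toLp 2 ![y 0, y 1, s]))) (R (EuclideanSpace.single 2 1)) ^ 2 / Real.sqrt (inner ℝ (Literature.Analysis.FluidPDE.curl v (R (WithLp.toLp 2 ![y 0, y 1, s]))) (R (EuclideanSpace.single 2 1)) ^ 2 + ε ^ 2)) (∫ y : EuclideanSpace ℝ (Fin 2), ε ^ 2 / Real.sqrt (inner ℝ (Literature.Analysis.FluidPDE.curl v (R (WithLp.toLp 2 ![y 0, y 1, s]))) (R (EuclideanSpace.single 2 1)) ^ 2 + ε ^ 2) ^ 3 * fderiv ℝ (fun z => inner ℝ (Literature.Analysis.FluidPDE.curl v z) (R (EuclideanSpace.single 2 1))) (R (WithLp.toLp 2 ![y 0, y 1, s])) (Literature.Analysis.FluidPDE.curl v (R (WithLp.toLp 2 ![y 0, y 1, s])))) s := by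
  intro ε hε R v C hv hC s
  have hv2 : ContDiff ℝ 2 v := contDiff_infty.1 hv 2
  set n : EuclideanSpace ℝ (Fin 3) := R (EuclideanSpace.single 2 1) with hn_def
  set b₀ : EuclideanSpace ℝ (Fin 3) := R (EuclideanSpace.single 0 1) with hb₀_def
  set b₁ : EuclideanSpace ℝ (Fin 3) := R (EuclideanSpace.single 1 1) with hb₁_def
  set Ω : EuclideanSpace ℝ (Fin 3) → EuclideanSpace ℝ (Fin 3) := curl v with hΩ_def
  /- 1. smoothness and continuity of the atoms -/
  have hΩ : ContDiff ℝ ∞ Ω := SlicedKelvinPlanarFluxAPriori.contDiff_curl hv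
  have hf : ContDiff ℝ ∞ (fun z => ⟪Ω z, n⟫) := contDiff_inner_curl hv _
  have hH : ContDiff ℝ ∞ (fun z => ⟪Ω z, n⟫ / Real.sqrt (⟪Ω z, n⟫ ^ 2 + ε ^ 2)) :=
    (contDiff_div_sqrtReg hε).comp hf
  have hGC : ∀ e : EuclideanSpace ℝ (Fin 3),
      ContDiff ℝ ∞ (fun z => ⟪Ω z, n⟫ / Real.sqrt (⟪Ω z, n⟫ ^ 2 + ε ^ 2) * ⟪Ω z, e⟫) :=
    fun e => hH.mul (contDiff_inner_const hΩ e)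
  have hGD : ∀ e : EuclideanSpace ℝ (Fin 3),
      Differentiable ℝ (fun z => ⟪Ω z, n⟫ / Real.sqrt (⟪Ω z, n⟫ ^ 2 + ε ^ 2) * ⟪Ω z, e⟫) :=
    fun e => (hGC e).differentiable (by simp)
  have hΩd : ∀ z, DifferentiableAt ℝ Ω z := fun z => hΩ.differentiable (by simp) z
  have cΩ : Continuous Ω := hΩ.continuous
  have cDΩ : Continuous (fderiv ℝ Ω) := hΩ.continuous_fderiv (by simp)
  have cDf : Continuous (fderiv ℝ (fun z => ⟪Ω z, n⟫)) := hf.continuous_fderiv (by simp)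
  have cH : Continuous (fun z => ⟪Ω z, n⟫ / Real.sqrt (⟪Ω z, n⟫ ^ 2 + ε ^ 2)) := hH.continuous
  have cG : Continuous (fun z => Real.sqrt (⟪Ω z, n⟫ ^ 2 + ε ^ 2)) :=
    (contDiff_sqrtReg_inner_curl hv hε n).continuous
  have cF2 : Continuous (fun z => ε ^ 2 / Real.sqrt (⟪Ω z, n⟫ ^ 2 + ε ^ 2) ^ 3) :=
    continuous_const.div (cG.pow 3) fun x => by positivity
  /- 2. pointwise derivatives -/
  have hDG : ∀ (e h x : EuclideanSpace ℝ (Fin 3)),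
      fderiv ℝ (fun z => ⟪Ω z, n⟫ / Real.sqrt (⟪Ω z, n⟫ ^ 2 + ε ^ 2) * ⟪Ω z, e⟫) x h =
        ⟪Ω x, n⟫ / Real.sqrt (⟪Ω x, n⟫ ^ 2 + ε ^ 2) * ⟪e, fderiv ℝ Ω x h⟫ +
          ⟪Ω x, e⟫ * (ε ^ 2 / Real.sqrt (⟪Ω x, n⟫ ^ 2 + ε ^ 2) ^ 3 * ⟪n, fderiv ℝ Ω x h⟫) :=
    fun e h x => apexLipschitz_fderiv_signReg_mul_inner_apply hε (hΩd x) n e h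
  have hkey : ∀ x : EuclideanSpace ℝ (Fin 3),
      fderiv ℝ (fun z => ⟪Ω z, n⟫ / Real.sqrt (⟪Ω z, n⟫ ^ 2 + ε ^ 2) * ⟪Ω z, n⟫) x n =
        ε ^ 2 / Real.sqrt (⟪Ω x, n⟫ ^ 2 + ε ^ 2) ^ 3 * fderiv ℝ (fun z => ⟪Ω z, n⟫) x (Ω x) -
          fderiv ℝ (fun z => ⟪Ω z, n⟫ / Real.sqrt (⟪Ω z, n⟫ ^ 2 + ε ^ 2) * ⟪Ω z, b₀⟫) x b₀ -
          fderiv ℝ (fun z => ⟪Ω z, n⟫ / Real.sqrt (⟪Ω z, n⟫ ^ 2 + ε ^ 2) * ⟪Ω z, b₁⟫) x b₁ :=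
    fun x => apexLipschitz_fderiv_signReg_normal_eq hε R (hΩd x) (divergence_curl_eq_zero_holds v hv2 x)
  /- 3. decay of the atoms and bounded factors -/
  have hn : ‖n‖ = 1 := norm_frame R 2
  have he0 : ‖b₀‖ = 1 := norm_frame R 0
  have he1 : ‖b₁‖ = 1 := norm_frame R 1
  obtain ⟨dΩ0, dΩ1, -⟩ := decay_zero_one_two fun x k hk => decay_iteratedFDeriv_curl hv hC x k hk
  obtain ⟨-, df1, -⟩ :=
    decay_zero_one_two fun x k hk => decay_iteratedFDeriv_inner_curl hv hC n x k hk
  have BF1 := bdd_div_sqrtReg_comp ε (fun z => ⟪Ω z, n⟫)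
  have BF2 := bdd_sq_div_sqrtReg_comp_cube hε (fun z => ⟪Ω z, n⟫)
  beta_reduce at BF1 BF2
  have hK0 : 0 ≤ ‖curlCLM‖ * C := le_trans (by positivity) (dΩ0 0)
  have hB : ∀ x, ‖Ω x‖ ≤ ‖curlCLM‖ * C := fun x => by
    obtain ⟨B, hB⟩ := bdd_of_decay ⟨_, dΩ0⟩
    have h1 : (1 : ℝ) ≤ (1 + ‖x‖) ^ 3 := one_le_pow₀ (by simp)
    calc ‖Ω x‖ = 1 * ‖Ω x‖ := (one_mul _).symm
      _ ≤ (1 + ‖x‖) ^ 3 * ‖Ω x‖ := by gcongr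
      _ ≤ ‖curlCLM‖ * C := dΩ0 x
  /- 4. plane integrability of `G_e`, `D G_e[e]` (`e` a unit vector) and of `H'(f) Df[ω]` -/
  have IG : ∀ e : EuclideanSpace ℝ (Fin 3), ‖e‖ = 1 → Integrable (fun y : EuclideanSpace ℝ (Fin 2) =>
      ⟪Ω (R (WithLp.toLp 2 ![y 0, y 1, s])), n⟫ /
        Real.sqrt (⟪Ω (R (WithLp.toLp 2 ![y 0, y 1, s])), n⟫ ^ 2 + ε ^ 2) *
        ⟪Ω (R (WithLp.toLp 2 ![y 0, y 1, s])), e⟫) := fun e he => by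
    obtain ⟨K, hK⟩ := bdd_mul_decay BF1 (decay_inner_of_decay dΩ0 he)
    exact integrable_comp_planeChart_of_decay R s (hGC e).continuous hK
  have IDG : ∀ e : EuclideanSpace ℝ (Fin 3), ‖e‖ = 1 → Integrable (fun y : EuclideanSpace ℝ (Fin 2) =>
      fderiv ℝ (fun z => ⟪Ω z, n⟫ / Real.sqrt (⟪Ω z, n⟫ ^ 2 + ε ^ 2) * ⟪Ω z, e⟫)
        (R (WithLp.toLp 2 ![y 0, y 1, s])) e) := fun e he => by
    have cont : Continuous fun x =>
        fderiv ℝ (fun z => ⟪Ω z, n⟫ / Real.sqrt (⟪Ω z, n⟫ ^ 2 + ε ^ 2) * ⟪Ω z, e⟫) x e := by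
      simp only [hDG]
      exact (cH.mul (continuous_const.inner (cDΩ.clm_apply continuous_const))).add
        ((cΩ.inner continuous_const).mul (cF2.mul
          (continuous_const.inner (cDΩ.clm_apply continuous_const))))
    obtain ⟨K, hK⟩ : ∃ K : ℝ, ∀ x, (1 + ‖x‖) ^ 3 *
        ‖fderiv ℝ (fun z => ⟪Ω z, n⟫ / Real.sqrt (⟪Ω z, n⟫ ^ 2 + ε ^ 2) * ⟪Ω z, e⟫) x e‖ ≤ K := by
      simp only [hDG]
      exact decay_add (bdd_mul_decay BF1 (decay_inner_fderiv_of_decay dΩ1 he he))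
        (bdd_mul_decay (bdd_of_decay (decay_inner_of_decay dΩ0 he))
          (bdd_mul_decay BF2 (decay_inner_fderiv_of_decay dΩ1 hn he)))
    exact integrable_comp_planeChart_of_decay R s cont hK
  have cP : Continuous fun x => ε ^ 2 / Real.sqrt (⟪Ω x, n⟫ ^ 2 + ε ^ 2) ^ 3 *
      fderiv ℝ (fun z => ⟪Ω z, n⟫) x (Ω x) := cF2.mul (cDf.clm_apply cΩ)
  obtain ⟨KP, hKP⟩ : ∃ K : ℝ, ∀ x, (1 + ‖x‖) ^ 3 *
      ‖ε ^ 2 / Real.sqrt (⟪Ω x, n⟫ ^ 2 + ε ^ 2) ^ 3 * fderiv ℝ (fun z => ⟪Ω z, n⟫) x (Ω x)‖ ≤ K :=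
    bdd_mul_decay BF2 (apexLipschitz_decay_clm_apply df1 ⟨_, hB⟩)
  have IP := integrable_comp_planeChart_of_decay R s cP hKP
  /- 5. the in-plane divergence integrates to zero -/
  have hDiv0 : ∫ y : EuclideanSpace ℝ (Fin 2),
      fderiv ℝ (fun z => ⟪Ω z, n⟫ / Real.sqrt (⟪Ω z, n⟫ ^ 2 + ε ^ 2) * ⟪Ω z, b₀⟫)
        (R (WithLp.toLp 2 ![y 0, y 1, s])) b₀ = 0 :=
    integral_fderiv_planeChart_eq_zero R s 0 _ (hGD b₀) (IG b₀ he0) (IDG b₀ he0)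
  have hDiv1 : ∫ y : EuclideanSpace ℝ (Fin 2),
      fderiv ℝ (fun z => ⟪Ω z, n⟫ / Real.sqrt (⟪Ω z, n⟫ ^ 2 + ε ^ 2) * ⟪Ω z, b₁⟫)
        (R (WithLp.toLp 2 ![y 0, y 1, s])) b₁ = 0 :=
    integral_fderiv_planeChart_eq_zero R s 1 _ (hGD b₁) (IG b₁ he1) (IDG b₁ he1)
  /- 6. differentiate the plane integral of `G_n` under the integral sign -/
  have hDGn : ∀ x, fderiv ℝ (fun z => ⟪Ω z, n⟫ / Real.sqrt (⟪Ω z, n⟫ ^ 2 + ε ^ 2) * ⟪Ω z, n⟫) x =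
      (⟪Ω x, n⟫ / Real.sqrt (⟪Ω x, n⟫ ^ 2 + ε ^ 2)) • ((innerSL ℝ n).comp (fderiv ℝ Ω x)) +
        ⟪Ω x, n⟫ • ((ε ^ 2 / Real.sqrt (⟪Ω x, n⟫ ^ 2 + ε ^ 2) ^ 3) •
          ((innerSL ℝ n).comp (fderiv ℝ Ω x))) :=
    fun x => (apexLipschitz_hasFDerivAt_signReg_mul_inner hε (hΩd x) n n).fderiv
  have hLn : ∀ x, ‖(innerSL ℝ n).comp (fderiv ℝ Ω x)‖ ≤ ‖fderiv ℝ Ω x‖ := fun x =>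
    (ContinuousLinearMap.opNorm_comp_le _ _).trans (by rw [norm_innerSL_unit hn, one_mul])
  have h0 : ∀ x, |⟪Ω x, n⟫ / Real.sqrt (⟪Ω x, n⟫ ^ 2 + ε ^ 2) * ⟪Ω x, n⟫| ≤
      (‖curlCLM‖ * C) * (1 + ‖x‖) ^ (-(3 : ℝ)) := fun x => by
    apply le_mul_rpow_neg_three
    calc (1 + ‖x‖) ^ 3 * |⟪Ω x, n⟫ / Real.sqrt (⟪Ω x, n⟫ ^ 2 + ε ^ 2) * ⟪Ω x, n⟫|
        ≤ (1 + ‖x‖) ^ 3 * ‖Ω x‖ := by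
          gcongr
          rw [abs_mul]
          calc _ ≤ 1 * ‖Ω x‖ := mul_le_mul (abs_div_sqrt_sq_add_sq_le_one _ _)
                ((Real.norm_eq_abs _).symm.trans_le (norm_inner_le_of_norm_eq_one hn))
                (abs_nonneg _) zero_le_one
            _ = ‖Ω x‖ := one_mul _
      _ ≤ ‖curlCLM‖ * C := dΩ0 x
  have h1 : ∀ x, ‖fderiv ℝ (fun z => ⟪Ω z, n⟫ / Real.sqrt (⟪Ω z, n⟫ ^ 2 + ε ^ 2) * ⟪Ω z, n⟫) x‖ ≤
      ((1 + ‖curlCLM‖ * C * ε⁻¹) * (‖curlCLM‖ * C)) * (1 + ‖x‖) ^ (-(3 : ℝ)) := fun x => by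
    apply le_mul_rpow_neg_three
    have hle : ‖fderiv ℝ (fun z => ⟪Ω z, n⟫ / Real.sqrt (⟪Ω z, n⟫ ^ 2 + ε ^ 2) * ⟪Ω z, n⟫) x‖ ≤
        (1 + ‖curlCLM‖ * C * ε⁻¹) * ‖fderiv ℝ Ω x‖ := by
      rw [hDGn x]
      refine (norm_add_le _ _).trans ?_
      rw [norm_smul, norm_smul, norm_smul]
      have hH1 : ‖⟪Ω x, n⟫ / Real.sqrt (⟪Ω x, n⟫ ^ 2 + ε ^ 2)‖ ≤ 1 :=
        (Real.norm_eq_abs _).trans_le (abs_div_sqrt_sq_add_sq_le_one _ _)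
      have hH2 : ‖ε ^ 2 / Real.sqrt (⟪Ω x, n⟫ ^ 2 + ε ^ 2) ^ 3‖ ≤ ε⁻¹ := by
        rw [Real.norm_eq_abs, abs_of_nonneg (sq_div_sqrt_cube_nonneg _ _)]
        exact sq_div_sqrt_cube_le hε _
      have hfn : ‖⟪Ω x, n⟫‖ ≤ ‖curlCLM‖ * C := (norm_inner_le_of_norm_eq_one hn).trans (hB x)
      calc ‖⟪Ω x, n⟫ / Real.sqrt (⟪Ω x, n⟫ ^ 2 + ε ^ 2)‖ * ‖(innerSL ℝ n).comp (fderiv ℝ Ω x)‖ +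
            ‖⟪Ω x, n⟫‖ * (‖ε ^ 2 / Real.sqrt (⟪Ω x, n⟫ ^ 2 + ε ^ 2) ^ 3‖ *
              ‖(innerSL ℝ n).comp (fderiv ℝ Ω x)‖)
          ≤ 1 * ‖fderiv ℝ Ω x‖ + ‖curlCLM‖ * C * (ε⁻¹ * ‖fderiv ℝ Ω x‖) :=
            add_le_add (mul_le_mul hH1 (hLn x) (norm_nonneg _) zero_le_one)
              (mul_le_mul hfn (mul_le_mul hH2 (hLn x) (norm_nonneg _) (inv_nonneg.2 hε.le))
                (by positivity) hK0)
        _ = (1 + ‖curlCLM‖ * C * ε⁻¹) * ‖fderiv ℝ Ω x‖ := by ring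
    calc (1 + ‖x‖) ^ 3 * ‖fderiv ℝ (fun z => ⟪Ω z, n⟫ / Real.sqrt (⟪Ω z, n⟫ ^ 2 + ε ^ 2) *
          ⟪Ω z, n⟫) x‖
        ≤ (1 + ‖x‖) ^ 3 * ((1 + ‖curlCLM‖ * C * ε⁻¹) * ‖fderiv ℝ Ω x‖) := by gcongr
      _ = (1 + ‖curlCLM‖ * C * ε⁻¹) * ((1 + ‖x‖) ^ 3 * ‖fderiv ℝ Ω x‖) := by ring
      _ ≤ (1 + ‖curlCLM‖ * C * ε⁻¹) * (‖curlCLM‖ * C) :=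
          mul_le_mul_of_nonneg_left (dΩ1 x) (by positivity)
  have hmain : HasDerivAt (fun c : ℝ => ∫ y : EuclideanSpace ℝ (Fin 2),
      ⟪Ω (R (WithLp.toLp 2 ![y 0, y 1, c])), n⟫ /
        Real.sqrt (⟪Ω (R (WithLp.toLp 2 ![y 0, y 1, c])), n⟫ ^ 2 + ε ^ 2) *
        ⟪Ω (R (WithLp.toLp 2 ![y 0, y 1, c])), n⟫)
      (∫ y : EuclideanSpace ℝ (Fin 2),
        fderiv ℝ (fun z => ⟪Ω z, n⟫ / Real.sqrt (⟪Ω z, n⟫ ^ 2 + ε ^ 2) * ⟪Ω z, n⟫)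
          (R (WithLp.toLp 2 ![y 0, y 1, s])) n) s :=
    hasDerivAt_planeIntegral_height R _ _ _ (contDiff_infty.1 (hGC n) 1) h0 h1 s
  /- 7. rewrite the derivative by the apex identity and the function by `f²/√ = H(f) f` -/
  have hval : ∫ y : EuclideanSpace ℝ (Fin 2),
      fderiv ℝ (fun z => ⟪Ω z, n⟫ / Real.sqrt (⟪Ω z, n⟫ ^ 2 + ε ^ 2) * ⟪Ω z, n⟫)
        (R (WithLp.toLp 2 ![y 0, y 1, s])) n =
      ∫ y : EuclideanSpace ℝ (Fin 2),
        ε ^ 2 / Real.sqrt (⟪Ω (R (WithLp.toLp 2 ![y 0, y 1, s])), n⟫ ^ 2 + ε ^ 2) ^ 3 *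
          fderiv ℝ (fun z => ⟪Ω z, n⟫) (R (WithLp.toLp 2 ![y 0, y 1, s]))
            (Ω (R (WithLp.toLp 2 ![y 0, y 1, s]))) := by
    rw [integral_congr_ae (ae_of_all _ fun y : EuclideanSpace ℝ (Fin 2) =>
      hkey (R (WithLp.toLp 2 ![y 0, y 1, s])))]
    have h12 : Integrable (fun y : EuclideanSpace ℝ (Fin 2) =>
        ε ^ 2 / Real.sqrt (⟪Ω (R (WithLp.toLp 2 ![y 0, y 1, s])), n⟫ ^ 2 + ε ^ 2) ^ 3 *
          fderiv ℝ (fun z => ⟪Ω z, n⟫) (R (WithLp.toLp 2 ![y 0, y 1, s]))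
            (Ω (R (WithLp.toLp 2 ![y 0, y 1, s]))) -
        fderiv ℝ (fun z => ⟪Ω z, n⟫ / Real.sqrt (⟪Ω z, n⟫ ^ 2 + ε ^ 2) * ⟪Ω z, b₀⟫)
          (R (WithLp.toLp 2 ![y 0, y 1, s])) b₀) := IP.sub (IDG b₀ he0)
    rw [integral_sub h12 (IDG b₁ he1), integral_sub IP (IDG b₀ he0), hDiv0, hDiv1, sub_zero,
      sub_zero]
  rw [hval] at hmain
  have hfun : ∀ c : ℝ, (∫ y : EuclideanSpace ℝ (Fin 2),
      ⟪Ω (R (WithLp.toLp 2 ![y 0, y 1, c])), n⟫ ^ 2 /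
        Real.sqrt (⟪Ω (R (WithLp.toLp 2 ![y 0, y 1, c])), n⟫ ^ 2 + ε ^ 2)) =
      ∫ y : EuclideanSpace ℝ (Fin 2),
        ⟪Ω (R (WithLp.toLp 2 ![y 0, y 1, c])), n⟫ /
          Real.sqrt (⟪Ω (R (WithLp.toLp 2 ![y 0, y 1, c])), n⟫ ^ 2 + ε ^ 2) *
          ⟪Ω (R (WithLp.toLp 2 ![y 0, y 1, c])), n⟫ :=
    fun c => integral_congr_ae (ae_of_all _ fun y => by ring)
  exact hmain.congr_of_eventuallyEq (Filter.Eventually.of_forall hfun)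

end Summit.NavierStokesRegularity.NavierStokesRegularity.Theorems.SlicedKelvinPlanarFluxAPriori

end
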